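import Summits.BirchSwinnertonDyer.Rank1Residual.X11b.KolyvaginHpointsAssembly
import HarnessLib

/-!
# Leaf (A′) ASSEMBLED at concrete currency AT ONE PRIME `p`: the `hpoints` binder of
# `KolyvaginDescent.sha_primary_finite_at_of_pointsM_of_reciprocityM`, by per-level choice,
# modulo the cite-only printed inputs at `p`

Cell `b2b-bsdres`, team x11b3 (N8/O2); seat x11b3-p2 GEN 35 ((P2-PERPRIME)), the per-prime
companion of `X11b/KolyvaginHpointsAssembly` (x11b3-p2 GEN 13, `hpoints_of_perLevelChoice`).
Summit-side THEOREM-ONLY file (no definition, no named fact, no `sorry`); `K : Type`; ONE generic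
odd prime `p` with `ρ̄_{E,p}` onto.

HONEST FRAMING (binding): **plumbing — an ASSEMBLY, not a discharge; the SAME assembly as
`hpoints_of_perLevelChoice`, with the prime `p` fixed instead of universally quantified.**  The
tree's per-prime descent `KolyvaginDescent.sha_primary_finite_at_of_pointsM_of_reciprocityM`
(`HeegnerPointsKolyvaginPrimaryAtPrimeProofs`: `Ш(E/K)[p^∞]` finite at one odd surjective `p`,
McCallum 1991 §1 Theorem as printed — per prime) takes leaf (A′) as a binder `hpoints` quantified
over the levels `M ≥ 1` of that one `p`.  THIS FILE builds that binder from the five LABELLED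
cite-only inputs of `hpoints_of_perLevelChoice` RESTRICTED TO `p` — each label below is the
all-`p` label of that theorem with its quantifier `{p M : ℕ} (_hp : p.Prime)` (and, for `hGZ`,
`(_hp2 : p ≠ 2) (_hρ : ρ̄_{E,p} onto)`) replaced by `{M : ℕ}`, the prime being the file's outer
`p`, every other token unchanged:
* `hrec` — Shimura reciprocity at conductor `1`, the EXISTING named fact
  `heegnerPointOfConductor_one_galoisConj N W K` (unchanged; `p`-free);
* `hCM` — Gross §3 CM rationality of `x_m` over `K_m` at the square-free Kolyvagin levels of
  `(p, M)`, every `M ≥ 1`;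
* `h53` — (A′-53) = Gross Prop. 5.3 at conductor `m`, printed form, `ε = −w(E)`, at the levels
  of `(p, M)`;
* `hGZ` — [GZ86 III (3.1)] as Gross p. 245 uses it, `∃ n′` prime to `p^M`, at the levels of
  `(p, M)` — the conclusion of `KolyvaginHloc.hGZ_of_kodairaNeron` (x11b3-p2 GEN 34, p319336) at
  this `p` closed over `(M, n, hKol, d)`, so that on the Kodaira–Néron sub-class AT `p` ({`p ∤
  ord_v Δ_min` at multiplicative `v`; `p ≠ 3` or no IV / IV* additive place}) it is SUPPLIED by
  that tree theorem — at `p` alone, not at every odd surjective prime;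
* `hγ` — (γ) = Gross Prop. 3.7 (2) at the levels of `(p, M)`.
Specialising the all-`p` labels of `hpoints_of_perLevelChoice` at `p` yields these, so the file
asks for LESS than its companion; the proof is that theorem's proof with `p` held fixed (every
label was only ever used at the ambient `(p, M)`): witnesses `ε := −w(E)`, `τ := liftAut c`,
`A_m := E(K[lev m])`, `P_m := P(lev m)` on x11b3-p8's coherent tower with top `lev m`; image
binder free (`ρ̄_{E,p}` onto, x11b3-p3); `hPt` / `hI` from x11b3-p4 at the level data; clause
(a) x11b3-p1 at `N = N_E`; (b) x11b3-p8; (c) x11b3-p1 modulo `hrec`; (d)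
`KolyvaginTauEigen.pointsMap_derivedPoint_concrete_of_prop53`; (e)
`KolyvaginHloc.hloc_concrete_of_GZ31`; (f) `KolyvaginH44.h44_concrete_of_traceRelation_of_congruence`
+ B2 `KolyvaginChoice.zsmul_kolyvaginClass_mem_iff` (once).  The §1 side conditions
(`discr_lt_neg_four`, `isCoprime_discr_of_satisfiesHeegnerHypothesis`,
`isOfFinAddOrder_map_sub_of_eq_conductorNorm`) are IMPORTED from the companion, not restated.
NOTHING DISCHARGED: (A′-53) / [GZ86 III (3.1)] / (γ) / `hrec` / CM rationality are labelled
hypotheses; node `Three.HsiehDescentAt₃` and its FOUR antecedents untouched; nothing booked; no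
mark / label / count / tier moves.

What is proved: **`KolyvaginAssembly.hpoints_at_of_perLevelChoice`** — for `W` globally minimal
and elliptic at its conductor `N`, `K` imaginary quadratic with `d_K ∉ {−3, −4}` and the Heegner
hypothesis, `P` a Heegner point, `p` odd with `ρ̄_{E,p}` onto: the `hpoints` binder of
`sha_primary_finite_at_of_pointsM_of_reciprocityM` (token for token) from {`hrec`, `hCM`, `h53`,
`hGZ`, `hγ`} at `p`.

References: [GrossLMS1991] B. H. Gross, *Kolyvagin's work on modular elliptic curves*, LMS LNS 153
(1991), §3, Prop. 3.7, §4 (4.1), Lemma 4.3, Props. 5.3, 5.4 (1), 6.2 (1) (held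
`book:editornd-l-functions-arithmetic`, chunks 215–222); [McCallumLMS1991] W. G. McCallum, same
volume, §1 Theorem (per prime), §4; [GrossZagier1986] III (3.1); [Darmon2004] Thm. 3.7, Prop. 3.11.
presearch: per-prime assembly → tree `lean search 'hpoints_at_of_perLevelChoice'` → none; the
all-`p` `hpoints_of_perLevelChoice` (p306701) is the only rendering; literature as in the companion
([corpus:book:editornd-l-functions-arithmetic chunk 218 L10], McCallum §1 p. 295 per-prime).
-/

noncomputable section

open scoped Classical
open WeierstrassCurve Field NumberField IsDedekindDomain Finset
open Literature.NumberTheory.EllipticCurves Literature.NumberTheory.GaloisRepresentations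
open Literature.NumberTheory.EllipticCurves.KolyvaginCocycle
open Literature.NumberTheory.EllipticCurves.KolyvaginEuler
open Literature.NumberTheory.EllipticCurves.RingClassField
open Literature.NumberTheory.EllipticCurves.ModularForms

namespace Summit.BirchSwinnertonDyer.Rank1Residual.X11b.KolyvaginAssembly

-- `K : Type`: the tree's ring-class class field theory is universe `0`.
variable {K : Type} [Field K] [NumberField K] {N : ℕ} {W : WeierstrassCurve ℚ}

/-- **Leaf (A′) AT ONE PRIME — the `hpoints` binder of
`KolyvaginDescent.sha_primary_finite_at_of_pointsM_of_reciprocityM` — ASSEMBLED at concrete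
currency by per-level choice** (Gross 1991 §§3–6, McCallum 1991 §4; road (g3)): for `E = W/ℚ`
globally minimal and elliptic at its conductor `N` (`hN`), `K` imaginary quadratic with
`d_K ∉ {−3, −4}` and the Heegner hypothesis, `P` a Heegner point of level `N`, `p` an odd prime
with `ρ̄_{E,p}` onto, CONDITIONAL on the five LABELLED cite-only inputs `hrec`, `hCM`, `h53`,
`hGZ`, `hγ` AT `p` (the labels of `hpoints_of_perLevelChoice` with the quantifier over `p`
removed; NOT facts, NOT discharged), the conclusion is the `hpoints` binder of the per-prime
descent VERBATIM: for every `M ≥ 1`, every `hdiv` and the complex conjugation `c ≠ 1`, the data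
`(ε, τ, A, P_m)` with clauses (a)–(f).  Same witnesses and same proof as
`hpoints_of_perLevelChoice`, `p` held fixed.  ASSEMBLY, not a discharge; nothing booked.
[cite: GrossLMS1991, §3, Prop. 3.7 (2), §4 (4.1), Lemma 4.3, Props. 5.3, 5.4 (1), 6.2 (1)]
[cite: McCallumLMS1991, §1 Theorem (Kolyvagin), §4 (4)–(6), Lemma 4.3, Prop. 4.4]
[cite: GrossZagier1986, III (3.1)] [cite: Darmon2004, Thm. 3.7, Prop. 3.11] -/
theorem hpoints_at_of_perLevelChoice [NeZero N] [W.IsGloballyMinimal] [W.IsElliptic]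
    (hN : N = W.conductorNorm ℤ) (hK : IsImaginaryQuadratic K)
    (hD34 : NumberField.discr K ≠ -3 ∧ NumberField.discr K ≠ -4)
    (hH : SatisfiesHeegnerHypothesis N K) {P : (W.baseChange K).toAffine.Point}
    (hHP : IsHeegnerPoint N W K P) {p : ℕ} (hp : p.Prime) (hp2 : p ≠ 2)
    (hρ : W.HasSurjectiveModNGaloisRep p)
    (hrec : heegnerPointOfConductor_one_galoisConj N W K)
    (hCM : ∀ [W.IsElliptic] (_hK : IsImaginaryQuadratic K) (_hH : SatisfiesHeegnerHypothesis N K)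
      (Dt : ModularParametrizationData W N) (β : ℤ) (ι : K →+* ℂ),
      (4 * N : ℤ) ∣ β ^ 2 - NumberField.discr K →
      ∀ {M : ℕ}, 1 ≤ M → ∀ (m : ℕ), Squarefree m →
      (∀ q ∈ m.primeFactors, IsKolyvaginPrime N W K p q ∧ FrobEqFrobInfty W K (p ^ M) q) →
      ∃ y : (W.baseChange (ringClassField K ι m)).toAffine.Point,
        WeierstrassCurve.Affine.Point.map (W' := W) (ringClassField K ι m).subtype.toRatAlgHom y =
          heegnerPointComplexOfConductor Dt (NumberField.discr K) β m)
    (h53 : ∀ [W.IsElliptic] (_hK : IsImaginaryQuadratic K) (_hH : SatisfiesHeegnerHypothesis N K)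
      (Dt : ModularParametrizationData W N) (β : ℤ) (ι : K →+* ℂ) {M : ℕ}
      (_hM : 1 ≤ M) {n : ℕ} (_hn : Squarefree n)
      (_hKol : ∀ q ∈ n.primeFactors, IsKolyvaginPrime N W K p q ∧ FrobEqFrobInfty W K (p ^ M) q)
      (d : (m : ℕ) → m ∣ n → KolyvaginHeegnerData Dt β ι m) (m : ℕ) (hm : m ∣ n)
      (τm : ringClassField K ι m ≃ₐ[ℚ] ringClassField K ι m),
      (∀ x : ringClassField K ι m, ((τm x : ringClassField K ι m) : ℂ) = starRingEnd ℂ x) →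
      ∃ σ' ∈ ringClassGal ι m, IsOfFinAddOrder
        (pointGalHom W (ringClassField K ι m) τm (d m hm).y -
          (-W.rootNumber) • pointGalHom W (ringClassField K ι m) σ' (d m hm).y))
    (hGZ : ∀ [W.IsElliptic] (_hK : IsImaginaryQuadratic K) (_hH : SatisfiesHeegnerHypothesis N K)
      (Dt : ModularParametrizationData W N) (β : ℤ) (ι : K →+* ℂ) {M : ℕ} (_hM : 1 ≤ M) {n : ℕ}
      (_hn : Squarefree n)
      (_hKol : ∀ q ∈ n.primeFactors, IsKolyvaginPrime N W K p q ∧ FrobEqFrobInfty W K (p ^ M) q)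
      (d : (m : ℕ) → m ∣ n → KolyvaginHeegnerData Dt β ι m),
      ∃ n' : ℤ, IsCoprime ((p ^ M : ℕ) : ℤ) n' ∧
        ∀ (m : ℕ) (hm : m ∣ n) (γ : ringClassField K ι m ≃ₐ[ℚ] ringClassField K ι m),
          γ ∈ ringClassGal ι m → ∀ v : HeightOneSpectrum (𝓞 K),
            ¬ (W.baseChange K).HasGoodReductionAt v →
            n' • pointsMap (W.baseChange K) (v.adicCompletion K)
                ((d m hm).toGeomPoints (pointGalHom W (ringClassField K ι m) γ (d m hm).y)) ∈
              E0Receptacle (W.baseChange K) v ∧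
            ∀ (ℓ : ℕ) (hℓ : ℓ ∈ m.primeFactors)
              (hle : ringClassField K ι (m / ℓ) ≤ ringClassField K ι m),
              n' • pointsMap (W.baseChange K) (v.adicCompletion K)
                  ((d m hm).toGeomPoints (pointGalHom W (ringClassField K ι m) γ
                    (WeierstrassCurve.Affine.Point.map (W' := W)
                      ((RingClassField.inclusion ι hle).restrictScalars ℚ)
                      (d (m / ℓ)
                        ((Nat.div_dvd_of_dvd (Nat.dvd_of_mem_primeFactors hℓ)).trans hm)).y))) ∈
                E0Receptacle (W.baseChange K) v)
    (hγ : ∀ [W.IsElliptic] (_hK : IsImaginaryQuadratic K) (_hH : SatisfiesHeegnerHypothesis N K)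
      (Dt : ModularParametrizationData W N) (β : ℤ) (ι : K →+* ℂ) {M : ℕ}
      (_hM : 1 ≤ M) {n : ℕ} (_hn : Squarefree n)
      (_hKol : ∀ q ∈ n.primeFactors, IsKolyvaginPrime N W K p q ∧ FrobEqFrobInfty W K (p ^ M) q)
      (d : (m : ℕ) → m ∣ n → KolyvaginHeegnerData Dt β ι m)
      (m : ℕ) (hm : m ∣ n) (ℓ : ℕ) (hℓ : ℓ ∈ m.primeFactors) [Fact ℓ.Prime]
      (hΔ : ¬ (ℓ : ℤ) ∣ minimalDiscriminantInt W) (φ₀ : absoluteGaloisGroup (ZMod ℓ)),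
      (∀ x : AlgebraicClosure (ZMod ℓ), φ₀ • x = x ^ ℓ) →
      ∀ (hle : ringClassField K ι (m / ℓ) ≤ ringClassField K ι m)
        (γ : ringClassField K ι m ≃ₐ[ℚ] ringClassField K ι m), γ ∈ ringClassGal ι m →
        geomReduction hΔ ((RatClosure.pointsEquiv (K := K) W).symm
            ((d m hm).toGeomPoints (pointGalHom W (ringClassField K ι m) γ (d m hm).y))) =
          φ₀ • geomReduction hΔ ((RatClosure.pointsEquiv (K := K) W).symm
            ((d m hm).toGeomPoints (pointGalHom W (ringClassField K ι m) γ
              (WeierstrassCurve.Affine.Point.map (W' := W)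
                ((RingClassField.inclusion ι hle).restrictScalars ℚ)
                (d (m / ℓ)
                  ((Nat.div_dvd_of_dvd (Nat.dvd_of_mem_primeFactors hℓ)).trans hm)).y))))) :
    ∀ {M : ℕ} (_hM : 1 ≤ M)
      (hdiv : ∀ Q : geomPoints (W.baseChange K), ∃ R, ((p ^ M : ℕ) : ℤ) • R = Q)
      (c : K ≃ₐ[ℚ] K) (_hc : c ≠ 1),
      ∃ (ε : ℤ) (τ : AlgebraicClosure K ≃+* AlgebraicClosure K) (hτ : IsLiftOfAut c τ)
        (A : ℕ → AddSubgroup (geomPoints (W.baseChange K)))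
        (hA : ∀ m, KolyvaginCocycle.IsAdmissible (Field.absoluteGaloisGroup K) (A m)
          ((p ^ M : ℕ) : ℤ))
        (Pt : ℕ → geomPoints (W.baseChange K))
        (hPt : ∀ m, Pt m ∈
          KolyvaginCocycle.invPoints (Field.absoluteGaloisGroup K) (A m) ((p ^ M : ℕ) : ℤ)),
        (ε = 1 ∨ ε = -1) ∧
        IsOfFinAddOrder (Affine.Point.map (W' := W) (c : K →ₐ[ℚ] K) P - ε • P) ∧
        (∀ m, ∀ a ∈ A m, hτ.pointsMap W a ∈ A m) ∧
        Pt 1 = toGeomPoints (W.baseChange K) P ∧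
        (∀ m : ℕ, Squarefree m →
          (∀ q ∈ m.primeFactors, IsKolyvaginPrime N W K p q ∧ FrobEqFrobInfty W K (p ^ M) q) →
          (∃ B ∈ A m, hτ.pointsMap W (Pt m) =
            (ε * (-1) ^ m.primeFactors.card) • Pt m + ((p ^ M : ℕ) : ℤ) • B) ∧
          (∀ v : HeightOneSpectrum (𝓞 K), (m : 𝓞 K) ∉ v.asIdeal →
            kolyvaginClass (W.baseChange K) _ hdiv (hA m) (Pt m) (hPt m) ∈
              selmerLocalKer (W.baseChange K) (v.adicCompletion K) ((p ^ M : ℕ) : ℤ)) ∧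
          (∀ ℓ : ℕ, ℓ.Prime → ℓ ∣ m → ∀ v : HeightOneSpectrum (𝓞 K), (ℓ : 𝓞 K) ∈ v.asIdeal →
            ∀ a : ℕ, (((p : ℤ) ^ a) •
                kolyvaginClass (W.baseChange K) _ hdiv (hA m) (Pt m) (hPt m) ∈
                selmerLocalKer (W.baseChange K) (v.adicCompletion K) ((p ^ M : ℕ) : ℤ) ↔
              ((p : ℤ) ^ a) • kolyvaginClass (W.baseChange K) _ hdiv (hA (m / ℓ)) (Pt (m / ℓ))
                  (hPt (m / ℓ)) ∈
                (W.baseChange K).torsionLocalKer (v.adicCompletion K) ((p ^ M : ℕ) : ℤ)))) := by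
  intro M hM hdiv c hc
  have hD : NumberField.discr K < -4 := discr_lt_neg_four hK hD34
  have hND := isCoprime_discr_of_satisfiesHeegnerHypothesis hK hH
  -- the frame `(Dt, β, ι)` of the consumer's Heegner point (x11b3-p1), with clause (c) on it
  obtain ⟨Dt, β, ι, hβ, hc1⟩ := KolyvaginBottom.exists_frame_of_isHeegnerPoint hrec hK hH hHP
  let Kol : ℕ → Prop := fun m ↦ Squarefree m ∧
    ∀ q ∈ m.primeFactors, IsKolyvaginPrime N W K p q ∧ FrobEqFrobInfty W K (p ^ M) q
  let lev : ℕ → ℕ := fun m ↦ if Kol m then m else 1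
  have hKol1 : Kol 1 := ⟨squarefree_one, by simp⟩
  have hlev : ∀ m, Kol (lev m) := fun m ↦ by
    by_cases h : Kol m <;> simp only [lev, if_pos, if_neg, h, hKol1, not_false_eq_true]
  have hlev_eq : ∀ m, Kol m → lev m = m := fun m h ↦ if_pos h
  have hlev0 : ∀ m, lev m ≠ 0 := fun m ↦ Squarefree.ne_zero (hlev m).1
  have hinert : ∀ m, ∀ q ∈ (lev m).primeFactors, (Ideal.span {(q : 𝓞 K)}).IsPrime :=
    fun m q hq ↦ ((hlev m).2 q hq).1.2.2.2.2.1
  have hKdiv : ∀ (m k : ℕ), k ∣ lev m → Kol k := fun m k hk ↦ ⟨(hlev m).1.squarefree_of_dvd hk,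
    fun q hq ↦ (hlev m).2 q (Nat.primeFactors_mono hk (hlev0 m) hq)⟩
  -- CM data `y(k) ∈ E(K[k])` at the divisors of every `lev m` (labelled input `hCM` at `p`)
  have hy0 : ∀ (m k : ℕ), k ∣ lev m → ∃ y : (W.baseChange (ringClassField K ι k)).toAffine.Point,
      WeierstrassCurve.Affine.Point.map (W' := W) (ringClassField K ι k).subtype.toRatAlgHom y =
        heegnerPointComplexOfConductor Dt (NumberField.discr K) β k :=
    fun m k hk ↦ hCM hK hH Dt β ι hβ hM k (hKdiv m k hk).1 (hKdiv m k hk).2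
  choose y hy using hy0
  -- the coherent tower with top `lev m` (x11b3-p8) — ONE choice per level
  choose T hTy hTord hTσ hTβ1 hTgeom hTcoh using fun m ↦
    RingClassTower.exists_coherent_kolyvaginHeegnerData Dt hK ι (n := lev m) (hlev m).1
      (hinert m) hβ (y m) (hy m)
  have hKolT := fun m ↦ (hlev m).2
  -- admissibility of every `E(K[k]) ⊆ E(K̄)` in the towers: the image binder is FREE (x11b3-p3)
  have hA : ∀ (m k : ℕ) (hk : k ∣ lev m),
      IsAdmissible (absoluteGaloisGroup K) (T m k hk).pointsSubgroup ((p ^ M : ℕ) : ℤ) :=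
    fun m ↦ RingClassNoTorsion.isAdmissible_pointsSubgroup_of_dvd hK (hlev0 m) (T m) hp hp2 hρ M
  -- `hPt` (McCallum (4), x11b3-p4) and `hI` (L4.3 inertia) at the level data of `exists_levelData`
  have hPtI : ∀ m : ℕ,
      (∀ (k : ℕ) (hk : k ∣ lev m),
        (T m k hk).toGeomPoints (T m k hk).derivedPoint ∈
          invPoints (absoluteGaloisGroup K) (T m k hk).pointsSubgroup ((p ^ M : ℕ) : ℤ)) ∧
      (∀ (k : ℕ) (hk : k ∣ lev m), ∀ v : HeightOneSpectrum (𝓞 K), (k : 𝓞 K) ∉ v.asIdeal →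
        ∀ 𝔐 ∈ v.localPrimesAbove, ∀ t ∈ 𝔐.inertia (absoluteGaloisGroup (v.adicCompletion K)),
          resGal (K := K) (v.adicCompletion K) t • (T m k hk).toGeomPoints (T m k hk).derivedPoint =
            (T m k hk).toGeomPoints (T m k hk).derivedPoint) := by
    intro m
    have hn := (hlev m).1
    choose σ H f yy π j e hord hj hπρ hfsec hHρ hdict hjunk using
      fun k ↦ KolyvaginH44.exists_levelData (W := W) (Dt := Dt) (β := β) hK ι hn (hinert m) (T m) k
    letI hcg : ∀ k, CommGroup (ringClassGal ι k) := fun k ↦ { mul_comm := fun a b ↦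
      (KolyvaginH44.isMulCommutative_ringClassGal' hK ι k).is_comm.comm a b }
    haveI hfin : ∀ k, Finite (ringClassGal ι k) := KolyvaginH44.finite_ringClassGal hK ι
    letI act : ∀ k, DistribMulAction (ringClassGal ι k)
        ((W.baseChange (ringClassField K ι k)).toAffine.Point) := fun k ↦
      DistribMulAction.compHom _ ((pointGalHom W _).comp (ringClassGal ι k).subtype)
    letI hft : ∀ k, Fintype (ringClassGal ι k ⧸ H k) := fun k ↦ Fintype.ofFinite _
    have hsmul : ∀ (k) (g : ringClassGal ι k)
        (Q : (W.baseChange (ringClassField K ι k)).toAffine.Point), g • Q =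
        pointGalHom W _ (g : ringClassField K ι k ≃ₐ[ℚ] ringClassField K ι k) Q := fun _ _ _ ↦ rfl
    set ρ : ∀ k, ringClassGal ι k →* (ringClassField K ι k ≃ₐ[ℚ] ringClassField K ι k) :=
      fun k ↦ (ringClassGal ι k).subtype with hρdef
    have hρi : ∀ k, Function.Injective (ρ k) := fun k ↦ (ringClassGal ι k).subtype_injective
    have hj' : ∀ (k) (g : absoluteGaloisGroup K)
        (a : (W.baseChange (ringClassField K ι k)).toAffine.Point),
        j k (π k g • a) = g • j k a := fun k g a ↦ by rw [hsmul]; exact hj k g a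
    have hπρ' : ∀ (k) (τ : absoluteGaloisGroup K) (x : ringClassField K ι k),
        τ • e k x = e k (ρ k (π k τ) x) := fun k τ x ↦ hπρ k τ x
    -- G1: the abstract Kolyvagin point IS `P(k)` at the divisors (x11b3-p8)
    have hP : ∀ (k) (hk : k ∣ lev m),
        j k (kolyvaginPoint (σ k) k.primeFactors (f k) (yy k)) =
          (T m k hk).toGeomPoints (T m k hk).derivedPoint := by
      intro k hk
      obtain ⟨hjk, hyk, hσk, hfS⟩ := hdict k hk
      rw [hjk, hyk]
      congr 1
      have hbij := KolyvaginH37Bridge.bijOn_of_section_of_transversal (ρ k) (hρi k)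
        (H := H k) (Γ := ringClassGal ι k) (G₁ := ringClassGalOver ι k 1) (hHρ k)
        (S := ((T m k hk).S : Set _)) (fun s hs ↦ (T m k hk).S_subset s hs)
        (fun s hs ↦ ⟨⟨s, (T m k hk).S_subset s hs⟩, rfl⟩) (T m k hk).S_transversal (f k) (hfsec k)
        hfS
      exact KolyvaginH37Bridge.map_kolyvaginPoint_eq_derivedPoint
        (pointGalHom W (ringClassField K ι k)) (ρ k) (AddMonoidHom.id _) (fun g a ↦ hsmul k g a)
        (hn.squarefree_of_dvd hk) hσk (f k) hbij (T m k hk).y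
    have hyA := fun (k : ℕ) (hk : k ∣ lev m) ↦ (hdict k hk).2.1
    have hσA := fun (k : ℕ) (hk : k ∣ lev m) ↦ (hdict k hk).2.2.1
    refine ⟨fun k hk ↦ ?_, fun k hk w hkw 𝔐 h𝔐 t ht ↦ ?_⟩
    · have h := KolyvaginH44.kolyvaginPoint_mem_invPoints_of_dvd hK ι Dt hp hM hND hD hn
        (hKolT m) (T m) σ (fun k ↦ k.primeFactors) H f yy π j hj' ρ hρi (fun _ ↦ AddEquiv.refl _)
        (fun k _ g a ↦ hsmul k g a) hyA hσA (fun _ _ ↦ rfl) (fun k _ ↦ hfsec k) (fun k _ ↦ hHρ k)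
        k hk
      rwa [hP k hk, (hdict k hk).1] at h
    · exact hP k hk ▸ KolyvaginH44.smul_kolyvaginPoint_eq_of_mem_localInertia (W := W) hK ι σ
        (fun k ↦ k.primeFactors) H f yy π j hj' e ρ hρi hπρ' k w hkw 𝔐 h𝔐 t ht
  -- the concrete classes of the per-level data are McCallum's classes of `P(lev m)` (any `hdiv`)
  have hcl : ∀ m : ℕ,
      kolyvaginClass (W.baseChange K) ((p ^ M : ℕ) : ℤ) hdiv (hA m (lev m) dvd_rfl)
          ((T m (lev m) dvd_rfl).toGeomPoints (T m (lev m) dvd_rfl).derivedPoint)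
          ((hPtI m).1 (lev m) dvd_rfl) =
        (T m (lev m) dvd_rfl).kolyvaginClass hp M := fun m ↦ by
    rw [KolyvaginHeegnerData.kolyvaginClass_of_admissible _ hp M (hA m _ dvd_rfl)
      ((hPtI m).1 _ dvd_rfl)]
  -- same-level choice independence up to a unit (B2, x11b3-p2 GEN 12), across a level cast
  have hB2 : ∀ (m₀ k : ℕ) (hk : k ∣ lev m₀) (k' : ℕ), k' = k →
      ∀ (d' : KolyvaginHeegnerData Dt β ι k')
        (H : AddSubgroup (galH1Torsion (W.baseChange K) ((p ^ M : ℕ) : ℤ))) (t : ℤ),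
        t • d'.kolyvaginClass hp M ∈ H ↔ t • (T m₀ k hk).kolyvaginClass hp M ∈ H := by
    intro m₀ k hk k' hkk' d' H t; subst k'
    exact KolyvaginChoice.zsmul_kolyvaginClass_mem_iff hK ι Dt hp hM hND hD (hlev m₀).1 (hKolT m₀)
      (T m₀) hk d' (hA m₀ k hk) H t
  have hc1' : ∀ (k : ℕ), k = 1 → ∀ d : KolyvaginHeegnerData Dt β ι k,
      d.toGeomPoints d.derivedPoint = toGeomPoints (W.baseChange K) P := by
    rintro _ rfl d; exact hc1 d
  -- ASSEMBLY: `ε := −w(E)`, `τ := liftAut c`, `A m := E(K[lev m])`, `P_m := P(lev m)`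
  refine ⟨-W.rootNumber, liftAut c, isLiftOfAut_liftAut c,
    fun m ↦ (T m (lev m) dvd_rfl).pointsSubgroup, fun m ↦ hA m (lev m) dvd_rfl,
    fun m ↦ (T m (lev m) dvd_rfl).toGeomPoints (T m (lev m) dvd_rfl).derivedPoint,
    fun m ↦ (hPtI m).1 (lev m) dvd_rfl, ?_, ?_, ?_, ?_, ?_⟩
  · rcases W.rootNumber_eq_one_or with h | h -- (a) the sign
    · exact Or.inr (by rw [h])
    · exact Or.inl (by rw [h, neg_neg])
  · exact isOfFinAddOrder_map_sub_of_eq_conductorNorm hN hK hH hHP c hc -- (a) Darmon Prop. 3.11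
  · exact fun m ↦ RingClassConj.pointsMap_mem_pointsSubgroup hK (hlev0 m) (T m (lev m) dvd_rfl)
      (isLiftOfAut_liftAut c) -- (b) `τ`-stability of every `E(K[lev m])` (x11b3-p8)
  · exact hc1' (lev 1) (hlev_eq 1 hKol1) _ -- (c) `P_1 = y_K` (x11b3-p1, modulo `hrec`)
  · -- (d), (e), (f) at a Kolyvagin level `m` (so `lev m = m`)
    intro m hmsq hmkol
    have hlm : lev m = m := hlev_eq m ⟨hmsq, hmkol⟩
    refine ⟨?_, ?_, ?_⟩
    · -- (d) Gross Prop. 5.4 (1) (x11b3-p2 p301428), modulo (A′-53) at `ε = −w(E)`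
      obtain ⟨B, hB, hBeq⟩ := KolyvaginTauEigen.pointsMap_derivedPoint_concrete_of_prop53 hK ι hp hM
        Dt hND hD (hlev m).1 (hKolT m) (T m) hc (isLiftOfAut_liftAut c) (-W.rootNumber)
        (h53 hK hH Dt β ι hM (hlev m).1 (hKolT m) (T m)) (hA m) (lev m) dvd_rfl
      have hpf : (lev m).primeFactors = m.primeFactors := by rw [hlm]
      exact ⟨B, hB, by rwa [hpf] at hBeq⟩
    · -- (e) Gross Prop. 6.2 (1) / McCallum L4.3 at `v ∤ m` (x11b3-p2 p299176), mod [GZ86 III (3.1)]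
      intro v hv
      obtain ⟨n', hcop, hGZ'⟩ := hGZ hK hH Dt β ι hM (hlev m).1 (hKolT m) (T m)
      have hv' : ((lev m : ℕ) : 𝓞 K) ∉ v.asIdeal := by rw [hlm]; exact hv
      have h := KolyvaginHloc.hloc_concrete_of_GZ31 hK ι hp hM Dt hND hD (hlev m).1 (hKolT m) (T m)
        hcop hGZ' (hA m) (lev m) dvd_rfl v hv'
      rwa [← hcl m] at h
    · -- (f) McCallum Prop. 4.4 at `λ ∣ m` (p292923) mod (γ), inside `T m`; then B2 to `D (m/ℓ)`
      intro ℓ hℓ hℓm v hv a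
      have hℓlm : ℓ ∣ lev m := by rw [hlm]; exact hℓm
      have hKol' : Kol (m / ℓ) := hKdiv m (m / ℓ) (by rw [hlm]; exact Nat.div_dvd_of_dvd hℓm)
      have hlev' : lev (m / ℓ) = lev m / ℓ := by rw [hlev_eq _ hKol', hlm]
      have h44 := KolyvaginH44.h44_concrete_of_traceRelation_of_congruence hK ι hHP hp hp2 hM
        (W.exists_weilPairing_holds p) Dt hND hD (hlev m).1 (hKolT m) (T m) (hTcoh m)
        (hγ hK hH Dt β ι hM (hlev m).1 (hKolT m) (T m)) (hA m) (hPtI m).1 (hPtI m).2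
        (lev m) dvd_rfl ℓ hℓ hℓlm v hv a
      rw [hcl m, hcl (m / ℓ), h44]
      exact (hB2 m (lev m / ℓ) ((Nat.div_dvd_of_dvd hℓlm).trans dvd_rfl) (lev (m / ℓ)) hlev'
        (T (m / ℓ) (lev (m / ℓ)) dvd_rfl) _ _).symm

end Summit.BirchSwinnertonDyer.Rank1Residual.X11b.KolyvaginAssembly

end
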